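import Mathlib
import Summits.NavierStokesRegularity.NavierStokesRegularity.Theorems.TaoLadderRungTwoBreakBlowupRigidityOneCore
import Summits.NavierStokesRegularity.NavierStokesRegularity.Theses.TaoLadderRungTwoBreak
import HarnessLib

/-!
# By-name normal forms: K2(1) `TaoLadderRungTwoBreak.BlowupRigidityOne` (stmt-NavierStokesRegularity-20206) and the rung
  leaf `Target` are EQUIVALENT to their restrictions to tables with a SELF-SUSTAINING CORE of modes (of size `≥ 2` below
  the dyadic spread) — the complement (nilpotent tables) carries no robust blow-up at any scale ratio
  (`…NilpotentTables`, `…Core`; `--supports stmt-NavierStokesRegularity-20206`)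

MODEL lattice ODEs only; nothing here is a statement about the Navier–Stokes equations; NO item is closed.  DEF-FREE
bookkeeping over the route file (this module imports `Theses/TaoLadderRungTwoBreak`; the mathematics is in the
route-independent modules `…NilpotentTables`, `…Core`).

* `blowupRigidityOne_iff_core` — K2(1) ⟺ K2(1) demanded only of tables `α ∈ E₂(R)` carrying a non-empty set `C` of modes
  each driven by a monomial with both inputs in `C`, with `card C ≥ 2` whenever `R < 2`;
* `target_iff_core` — the same normal form for the rung leaf (BP-D-latt).
Together with `…LiveTables` (`fluxConst α ≥ R⁻¹`, `X₀ ≠ 0`) and `…VoidEternal` (two charged modes below `R < 2`) this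
is where any proof or refutation of K2(1) / the Target must work.  HONEST LABEL: bookkeeping; rung 0.
-/

noncomputable section

-- the summit and its single sub-problem share the name (CONVENTIONS §1)
set_option linter.dupNamespace false

open Set Filter Topology MeasureTheory

namespace Summit.NavierStokesRegularity.NavierStokesRegularity.Theorems

namespace BlowupRigidityOne

open Literature.Analysis.FluidPDE Literature.Analysis.FluidPDE.TaoCascade
open Summit.NavierStokesRegularity.NavierStokesRegularity.Theses.TaoLadderRungTwoBreak

/-- On `E₂(R)` (`ε₀ > 0`) a robust blow-up forces a self-sustaining core, of size `≥ 2` below the dyadic spread.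
[cite: Tao2016AveragedNS, §4 Thm. 4.2 (statement shape), (4.2)–(4.3); cell vocabulary (self-sustaining core)] -/
theorem core_two_of_noGlobalCascade {m : ℕ} {R ε₀ : ℝ} {α : Fin m → Fin m → Fin m → ℤ × ℤ × ℤ → ℝ}
    {X₀ : Fin m → ℝ} (hε : 0 < ε₀) (hR : 1 ≤ R) (hα : InTableClass R α) (hNG : NoGlobalCascade ε₀ α X₀) :
    ∃ C : Finset (Fin m), C.Nonempty ∧ (∀ i ∈ C, ∃ μ ∈ shiftSet, ∃ j ∈ C, ∃ k ∈ C, α j k i μ ≠ 0) ∧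
      (R < 2 → 2 ≤ C.card) := by
  obtain ⟨C, hC, hcore⟩ := core_of_noGlobalCascade hε hα hNG
  exact ⟨C, hC, hcore, fun hR2 => two_le_card_core_of_lt_two hα (by linarith) hR2 hC hcore⟩

/-- **K2(1) ⟺ K2(1) ON TABLES WITH A SELF-SUSTAINING CORE.**  `BlowupRigidityOne` is equivalent to the same
implication demanded only of tables carrying a non-empty set `C` of modes each driven from `C × C` (with `card C ≥ 2`
when `R < 2`): nilpotent tables never blow up robustly (`core_of_noGlobalCascade`, `two_le_card_core_of_lt_two`).
[cite: Tao2016AveragedNS, §4 Thm. 4.2 (statement shape); cell vocabulary (K2(1), self-sustaining core)] -/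
theorem blowupRigidityOne_iff_core :
    BlowupRigidityOne ↔
      ∀ R : ℝ, 1 ≤ R → ∃ εs : ℝ, 0 < εs ∧ ∀ ε₀ : ℝ, 0 < ε₀ → ε₀ ≤ εs →
        ∀ (α : Fin 4 → Fin 4 → Fin 4 → ℤ × ℤ × ℤ → ℝ) (X₀ : Fin 4 → ℝ), InTableClass R α →
          (∃ C : Finset (Fin 4), C.Nonempty ∧ (∀ i ∈ C, ∃ μ ∈ shiftSet, ∃ j ∈ C, ∃ k ∈ C, α j k i μ ≠ 0) ∧
            (R < 2 → 2 ≤ C.card)) →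
          NoGlobalCascade ε₀ α X₀ →
            ∃ (q : ℕ) (π : Equiv.Perm (Fin q)) (T : ℝ) (Φ : Fin q → ℝ → Em 4),
              IsDSSWave ε₀ α π T Φ ∧ Surviving 1 ε₀ T ∧ ∃ r x, Φ r x ≠ 0 := by
  constructor
  · intro h R hR
    obtain ⟨εs, hεs, H⟩ := h R hR
    exact ⟨εs, hεs, fun ε₀ hε hle α X₀ hα _ hNG => H ε₀ hε hle α X₀ hα hNG⟩
  · intro h R hR
    obtain ⟨εs, hεs, H⟩ := h R hR
    refine ⟨εs, hεs, fun ε₀ hε hle α X₀ hα hNG => H ε₀ hε hle α X₀ hα ?_ hNG⟩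
    exact core_two_of_noGlobalCascade hε hR hα hNG

/-- **The rung leaf ⟺ the rung leaf ON TABLES WITH A SELF-SUSTAINING CORE.**  `Target` (BP-D-latt) is equivalent to
the same statement demanded only of tables with a non-empty self-sustaining core (of size `≥ 2` when `R < 2`).
[cite: Tao2016AveragedNS, §4 Thm. 4.2 (statement shape); cell vocabulary (`Target` = `RungTwoBreakLatt`)] -/
theorem target_iff_core :
    Target ↔
      ∀ R : ℝ, 1 ≤ R → ∃ εR : ℝ, 0 < εR ∧ ∀ ε₀ : ℝ, 0 < ε₀ → ε₀ ≤ εR →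
        ∀ (α : Fin 4 → Fin 4 → Fin 4 → ℤ × ℤ × ℤ → ℝ) (X₀ : Fin 4 → ℝ), InTableClass R α →
          (∃ C : Finset (Fin 4), C.Nonempty ∧ (∀ i ∈ C, ∃ μ ∈ shiftSet, ∃ j ∈ C, ∃ k ∈ C, α j k i μ ≠ 0) ∧
            (R < 2 → 2 ≤ C.card)) →
          ¬ NoGlobalCascade ε₀ α X₀ := by
  constructor
  · intro h R hR
    obtain ⟨εR, hεR, H⟩ := h R hR
    exact ⟨εR, hεR, fun ε₀ hε hle α X₀ hα _ => H ε₀ hε hle α X₀ hα⟩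
  · intro h R hR
    obtain ⟨εR, hεR, H⟩ := h R hR
    refine ⟨εR, hεR, fun ε₀ hε hle α X₀ hα hNG => ?_⟩
    exact H ε₀ hε hle α X₀ hα (core_two_of_noGlobalCascade hε hR hα hNG) hNG

end BlowupRigidityOne

end Summit.NavierStokesRegularity.NavierStokesRegularity.Theorems

end
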